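import Mathlib
import Literature.Analysis.FluidPDE.TypeIICoreWitness
import Summits.NavierStokesRegularity.NavierStokesRegularity.Theorems.TypeIIInviscidRelaxationCoreExclusionAnchorReductionColumnar
import Summits.NavierStokesRegularity.NavierStokesRegularity.Theorems.TypeIIInviscidRelaxationCoreExclusionAnchorReductionAxisym
import HarnessLib

/-!
# Cruxes `ColumnarCoreExclusion` (stmt-1966) / `MonopoleCoreExclusion` (stmt-1965): BELOW the Euler rate the anchor
# stubs reduce to a CORE-RADIUS FLOOR ALONE

`--supports stmt-NavierStokesRegularity-1966` (helper file; theorems only, no definitions, no `sorry`).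

Dual of `…CoreExclusionAnchorReductionEulerRate` (p-landed; `anchoredLateWitness_of_lateWitnesses_eulerRate`: AT the
Euler rate `(T-t)‖u(t)‖∞ ≥ r₀` a LATE witness automatically has a core-radius floor).  Here the opposite regime: if the
blow-up is SUB-EULER — `(T - t)·‖u(t)‖_∞ → 0` as `t ↑ T`, stated as
`∀ r > 0, ∃ t₁ < T, ∀ t ∈ (t₁,T), ∀ x, (T - t)‖u(t,x)‖ ≤ r` — then a witness with a CORE-RADIUS FLOOR `r₀ ≤ K·L`
taken after `t₁(r₀/2)` is automatically LATE: the near-maximum clause `V ≤ 2‖u(t,x₁)‖` gives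
`(T - t)·V ≤ 2(T - t)‖u(t,x₁)‖ ≤ r₀ ≤ K·L`.  Hence (`anchoredLateWitness_of_lateWitnesses_radiusFloor`, p831087) the
full conclusion of the registered anchor stubs — a singular anchor `xs` and anchored late level-`K` witnesses for
every `K > 0` — follows from FLOOR witnesses at every level frequently.

* `CoreExclusionAnchor.late_of_floor_of_subEuler` — the one-line mechanism at a single witness time;
* `CoreExclusionAnchor.anchoredLateWitness_of_floorWitnesses_subEulerRate` (class-generic, dilation-stable `C`);
* `…Columnar…` / `…Axisym…` — the two stubs' classes, in their binder shape with `hw` replaced by "witnesses with a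
  core-radius floor at every level frequently" plus the sub-Euler hypothesis;
* `CoreExclusionAnchor.lateFloorWitnesses_iff_floorWitnesses_of_subEulerRate` — below the Euler rate the late-floor
  currency of p831087 and the bare floor currency coincide.

Rate map of the anchor residue «lateness ∧ floor» (all kernel-checked, this file + tree): Euler-rate floor ⇒
(late ⇒ floor) [EulerRate]; sub-Euler ⇒ (floor ⇒ late) [this file]; intermediate rates: late ⇏ floor
[…AnchorObstructionLate]; columnar late witnesses exist only under an Euler CEILING […ColumnarCoreExclusionCoreExtent].
So below the Euler rate — the regime containing every rate between Type I and `(T-t)⁻¹` — what the anchor stubs need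
beyond the crux hypothesis `hw` is EXACTLY a core-radius floor of the class witnesses.  The sub-Euler hypothesis is a
regime assumption, not a theorem: only Leray's LOWER rate bounds are known for Leray–Hopf blow-up (Seregin 2014,
Lecture Notes, p. 130).  Nothing about Navier–Stokes regularity is claimed; no stub or crux is proved here.
-/

noncomputable section

open Set Metric
open Literature.Analysis Literature.Analysis.FluidPDE

namespace Summit.NavierStokesRegularity.NavierStokesRegularity.Theorems

-- the problem directory repeats the summit name (`NavierStokesRegularity/NavierStokesRegularity`)
set_option linter.dupNamespace false

namespace CoreExclusionAnchor

/-- **A floor witness at a sub-Euler time is late.**  If `(T - t)‖u(t,x₁)‖ ≤ r₀/2` at the near-maximum point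
(`V ≤ 2‖u(t,x₁)‖`), `t ≤ T`, and the core radius has the floor `r₀ ≤ K·L`, then `(T - t)·V ≤ K·L`. [folklore] -/
theorem late_of_floor_of_subEuler {T t V K L r₀ : ℝ} {a : ℝ} (htT : t ≤ T) (hnear : V ≤ 2 * a)
    (hsub : (T - t) * a ≤ r₀ / 2) (hfloor : r₀ ≤ K * L) : (T - t) * V ≤ K * L := by
  have hTt : 0 ≤ T - t := sub_nonneg.2 htT
  have h1 : (T - t) * V ≤ (T - t) * (2 * a) := mul_le_mul_of_nonneg_left hnear hTt
  nlinarith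

/-- **Anchored late witnesses from floor witnesses below the Euler rate** (class-generic).  Let `C` be stable under
dilations `W ↦ W(c·)`, `c ≥ 1`; let `(u,p)` be a maximal smooth solution on `[0,T)`, Leray–Hopf from a rapidly
decaying datum, whose speed is SUB-EULER near `T`: `∀ r > 0, ∃ t₁ < T, ∀ t ∈ (t₁,T), ∀ x, (T-t)‖u(t,x)‖ ≤ r`.  Assume
class-`C` witnesses with a CORE-RADIUS FLOOR `r₀ ≤ K·L` occur at every level `K > 0` frequently before `T`.  Then
there is a singular point `xs` and, for every `K > 0`, a late level-`K` class-`C` witness anchored at `xs`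
(`dist xs x₀ ≤ KL/4`).  Proof: request the floor witness after `t₁(r₀/2)`; it is late by
`late_of_floor_of_subEuler`; apply `anchoredLateWitness_of_lateWitnesses_radiusFloor`. [folklore] -/
theorem anchoredLateWitness_of_floorWitnesses_subEulerRate
    {C : (EuclideanSpace ℝ (Fin 3) → EuclideanSpace ℝ (Fin 3)) → Prop}
    (hC : ∀ W, C W → ∀ c : ℝ, 1 ≤ c → C (fun y => W (c • y)))
    {ν T : ℝ} {u : ℝ → EuclideanSpace ℝ (Fin 3) → EuclideanSpace ℝ (Fin 3)}
    {p : ℝ → EuclideanSpace ℝ (Fin 3) → ℝ}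
    (hν : 0 < ν) (hT : 0 < T) (hmax : IsMaximalSmoothSolution ν 0 u p T)
    (hLH : IsLerayHopfOn T ν 0 (u 0) u) (hdec : HasRapidSpatialDecay (u 0))
    (hsub : ∀ r : ℝ, 0 < r → ∃ t₁ : ℝ, t₁ < T ∧ ∀ t ∈ Ioo t₁ T, ∀ x, (T - t) * ‖u t x‖ ≤ r)
    (hwfloor : ∃ r₀ : ℝ, 0 < r₀ ∧ ∀ K : ℝ, 0 < K → ∀ t₀ < T, ∃ t, t₀ < t ∧ t < T ∧
      ∃ (x₀ : EuclideanSpace ℝ (Fin 3)) (L V : ℝ)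
        (Q : EuclideanSpace ℝ (Fin 3) ≃ₗᵢ[ℝ] EuclideanSpace ℝ (Fin 3))
        (W : EuclideanSpace ℝ (Fin 3) → EuclideanSpace ℝ (Fin 3)),
        0 < L ∧ 0 < V ∧ C W ∧ (∀ x, ‖u t x‖ ≤ V) ∧
        (∃ x₁, dist x₁ x₀ ≤ L ∧ V ≤ 2 * ‖u t x₁‖) ∧
        (∃ y y' : EuclideanSpace ℝ (Fin 3), ‖y‖ ≤ 1 ∧ ‖y'‖ ≤ 1 ∧ (4 : ℝ)⁻¹ ≤ ‖W y - W y'‖) ∧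
        K * ν ≤ L * V ∧
        (∀ y : EuclideanSpace ℝ (Fin 3), ‖y‖ ≤ K →
          ‖V⁻¹ • Q.symm (u t (x₀ + L • Q y)) - W y‖ ≤ K⁻¹) ∧
        r₀ ≤ K * L) :
    ∃ xs : EuclideanSpace ℝ (Fin 3),
      (¬ ∃ ρ M : ℝ, 0 < ρ ∧ ∀ s ∈ Ioo (T - ρ ^ 2) T, ∀ x ∈ ball xs ρ, ‖u s x‖ ≤ M) ∧
      ∀ K : ℝ, 0 < K → ∃ t : ℝ, 0 < t ∧ t < T ∧
        ∃ (x₀ : EuclideanSpace ℝ (Fin 3)) (L V : ℝ)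
          (Q : EuclideanSpace ℝ (Fin 3) ≃ₗᵢ[ℝ] EuclideanSpace ℝ (Fin 3))
          (W : EuclideanSpace ℝ (Fin 3) → EuclideanSpace ℝ (Fin 3)),
          0 < L ∧ 0 < V ∧ C W ∧ (∀ x, ‖u t x‖ ≤ V) ∧
          (∃ x₁, dist x₁ x₀ ≤ L ∧ V ≤ 2 * ‖u t x₁‖) ∧
          (∃ y y' : EuclideanSpace ℝ (Fin 3), ‖y‖ ≤ 1 ∧ ‖y'‖ ≤ 1 ∧ (4 : ℝ)⁻¹ ≤ ‖W y - W y'‖) ∧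
          K * ν ≤ L * V ∧
          (∀ y : EuclideanSpace ℝ (Fin 3), ‖y‖ ≤ K →
            ‖V⁻¹ • Q.symm (u t (x₀ + L • Q y)) - W y‖ ≤ K⁻¹) ∧
          (T - t) * V ≤ K * L ∧ dist xs x₀ ≤ K * L / 4 := by
  obtain ⟨r₀, hr₀, hsel⟩ := hwfloor
  refine anchoredLateWitness_of_lateWitnesses_radiusFloor hC hν hT hmax hLH hdec ⟨r₀, hr₀, ?_⟩
  intro K hK t₀ ht₀
  obtain ⟨t₁, ht₁T, hsub₁⟩ := hsub (r₀ / 2) (by positivity)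
  obtain ⟨t, ht₀t, htT, x₀, L, V, Q, W, hL, hV, hW, hbd, hnear, hosc, hRe, hclose, hfloor⟩ :=
    hsel K hK (max t₀ t₁) (max_lt ht₀ ht₁T)
  refine ⟨t, (le_max_left t₀ t₁).trans_lt ht₀t, htT, x₀, L, V, Q, W, hL, hV, hW, hbd, hnear, hosc, hRe, hclose,
    ?_, hfloor⟩
  -- lateness: `(T - t) V ≤ 2 (T - t)‖u t x₁‖ ≤ r₀ ≤ K L`
  obtain ⟨x₁, -, hx₁⟩ := hnear
  exact late_of_floor_of_subEuler htT.le hx₁ (hsub₁ t ⟨(le_max_right t₀ t₁).trans_lt ht₀t, htT⟩ x₁) hfloor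

/-- **Below the Euler rate the late-floor and the floor currencies coincide** (class-generic).  For a field whose
speed is sub-Euler near `T`, "witnesses of class `C` with core-radius floor `r₀`, LATE, at every level frequently"
(the hypothesis `hwl` of `anchoredLateWitness_of_lateWitnesses_radiusFloor`) holds iff the same WITHOUT lateness
holds. [folklore] -/
theorem lateFloorWitnesses_iff_floorWitnesses_of_subEulerRate
    {C : (EuclideanSpace ℝ (Fin 3) → EuclideanSpace ℝ (Fin 3)) → Prop}
    {ν T : ℝ} {u : ℝ → EuclideanSpace ℝ (Fin 3) → EuclideanSpace ℝ (Fin 3)}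
    (hsub : ∀ r : ℝ, 0 < r → ∃ t₁ : ℝ, t₁ < T ∧ ∀ t ∈ Ioo t₁ T, ∀ x, (T - t) * ‖u t x‖ ≤ r) :
    (∃ r₀ : ℝ, 0 < r₀ ∧ ∀ K : ℝ, 0 < K → ∀ t₀ < T, ∃ t, t₀ < t ∧ t < T ∧
      ∃ (x₀ : EuclideanSpace ℝ (Fin 3)) (L V : ℝ)
        (Q : EuclideanSpace ℝ (Fin 3) ≃ₗᵢ[ℝ] EuclideanSpace ℝ (Fin 3))
        (W : EuclideanSpace ℝ (Fin 3) → EuclideanSpace ℝ (Fin 3)),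
        0 < L ∧ 0 < V ∧ C W ∧ (∀ x, ‖u t x‖ ≤ V) ∧
        (∃ x₁, dist x₁ x₀ ≤ L ∧ V ≤ 2 * ‖u t x₁‖) ∧
        (∃ y y' : EuclideanSpace ℝ (Fin 3), ‖y‖ ≤ 1 ∧ ‖y'‖ ≤ 1 ∧ (4 : ℝ)⁻¹ ≤ ‖W y - W y'‖) ∧
        K * ν ≤ L * V ∧
        (∀ y : EuclideanSpace ℝ (Fin 3), ‖y‖ ≤ K →
          ‖V⁻¹ • Q.symm (u t (x₀ + L • Q y)) - W y‖ ≤ K⁻¹) ∧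
        (T - t) * V ≤ K * L ∧ r₀ ≤ K * L) ↔
    (∃ r₀ : ℝ, 0 < r₀ ∧ ∀ K : ℝ, 0 < K → ∀ t₀ < T, ∃ t, t₀ < t ∧ t < T ∧
      ∃ (x₀ : EuclideanSpace ℝ (Fin 3)) (L V : ℝ)
        (Q : EuclideanSpace ℝ (Fin 3) ≃ₗᵢ[ℝ] EuclideanSpace ℝ (Fin 3))
        (W : EuclideanSpace ℝ (Fin 3) → EuclideanSpace ℝ (Fin 3)),
        0 < L ∧ 0 < V ∧ C W ∧ (∀ x, ‖u t x‖ ≤ V) ∧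
        (∃ x₁, dist x₁ x₀ ≤ L ∧ V ≤ 2 * ‖u t x₁‖) ∧
        (∃ y y' : EuclideanSpace ℝ (Fin 3), ‖y‖ ≤ 1 ∧ ‖y'‖ ≤ 1 ∧ (4 : ℝ)⁻¹ ≤ ‖W y - W y'‖) ∧
        K * ν ≤ L * V ∧
        (∀ y : EuclideanSpace ℝ (Fin 3), ‖y‖ ≤ K →
          ‖V⁻¹ • Q.symm (u t (x₀ + L • Q y)) - W y‖ ≤ K⁻¹) ∧
        r₀ ≤ K * L) := by
  constructor
  · rintro ⟨r₀, hr₀, hsel⟩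
    refine ⟨r₀, hr₀, fun K hK t₀ ht₀ => ?_⟩
    obtain ⟨t, ht₀t, htT, x₀, L, V, Q, W, hL, hV, hW, hbd, hnear, hosc, hRe, hclose, -, hfloor⟩ :=
      hsel K hK t₀ ht₀
    exact ⟨t, ht₀t, htT, x₀, L, V, Q, W, hL, hV, hW, hbd, hnear, hosc, hRe, hclose, hfloor⟩
  · rintro ⟨r₀, hr₀, hsel⟩
    refine ⟨r₀, hr₀, fun K hK t₀ ht₀ => ?_⟩
    obtain ⟨t₁, ht₁T, hsub₁⟩ := hsub (r₀ / 2) (by positivity)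
    obtain ⟨t, ht₀t, htT, x₀, L, V, Q, W, hL, hV, hW, hbd, hnear, hosc, hRe, hclose, hfloor⟩ :=
      hsel K hK (max t₀ t₁) (max_lt ht₀ ht₁T)
    refine ⟨t, (le_max_left t₀ t₁).trans_lt ht₀t, htT, x₀, L, V, Q, W, hL, hV, hW, hbd, hnear, hosc, hRe,
      hclose, ?_, hfloor⟩
    obtain ⟨x₁, -, hx₁⟩ := hnear
    exact late_of_floor_of_subEuler htT.le hx₁ (hsub₁ t ⟨(le_max_right t₀ t₁).trans_lt ht₀t, htT⟩ x₁) hfloor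

/-- **Crux `ColumnarCoreExclusion` (stmt-1966): below the Euler rate the anchor stub needs only a core-radius floor.**
Binder shape of the registered stub `stub_anchoredLateColumnarWitness` (line `columnar_comparison_flow`) with `hw`
replaced by columnar witnesses WITH A CORE-RADIUS FLOOR at every level frequently (`hwfloor`) and the sub-Euler
hypothesis (`hsub`); the conclusion is the stub's, verbatim. [folklore] -/
theorem anchoredLateColumnarWitness_of_floorWitnesses_subEulerRate {ν T : ℝ}
    {u : ℝ → EuclideanSpace ℝ (Fin 3) → EuclideanSpace ℝ (Fin 3)}
    {p : ℝ → EuclideanSpace ℝ (Fin 3) → ℝ}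
    (hν : 0 < ν) (hT : 0 < T) (hmax : IsMaximalSmoothSolution ν 0 u p T)
    (hLH : IsLerayHopfOn T ν 0 (u 0) u) (hdec : HasRapidSpatialDecay (u 0))
    (hsub : ∀ r : ℝ, 0 < r → ∃ t₁ : ℝ, t₁ < T ∧ ∀ t ∈ Ioo t₁ T, ∀ x, (T - t) * ‖u t x‖ ≤ r)
    (hwfloor : ∃ r₀ : ℝ, 0 < r₀ ∧ ∀ K : ℝ, 0 < K → ∀ t₀ < T, ∃ t, t₀ < t ∧ t < T ∧
      ∃ (x₀ : EuclideanSpace ℝ (Fin 3)) (L V : ℝ)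
        (Q : EuclideanSpace ℝ (Fin 3) ≃ₗᵢ[ℝ] EuclideanSpace ℝ (Fin 3))
        (W : EuclideanSpace ℝ (Fin 3) → EuclideanSpace ℝ (Fin 3)),
        0 < L ∧ 0 < V ∧ IsColumnar W ∧ (∀ x, ‖u t x‖ ≤ V) ∧
        (∃ x₁, dist x₁ x₀ ≤ L ∧ V ≤ 2 * ‖u t x₁‖) ∧
        (∃ y y' : EuclideanSpace ℝ (Fin 3), ‖y‖ ≤ 1 ∧ ‖y'‖ ≤ 1 ∧ (4 : ℝ)⁻¹ ≤ ‖W y - W y'‖) ∧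
        K * ν ≤ L * V ∧
        (∀ y : EuclideanSpace ℝ (Fin 3), ‖y‖ ≤ K →
          ‖V⁻¹ • Q.symm (u t (x₀ + L • Q y)) - W y‖ ≤ K⁻¹) ∧
        r₀ ≤ K * L) :
    ∃ xs : EuclideanSpace ℝ (Fin 3),
      (¬ ∃ ρ M : ℝ, 0 < ρ ∧ ∀ s ∈ Ioo (T - ρ ^ 2) T, ∀ x ∈ ball xs ρ, ‖u s x‖ ≤ M) ∧
      ∀ K : ℝ, 0 < K → ∃ t : ℝ, 0 < t ∧ t < T ∧
        ∃ (x₀ : EuclideanSpace ℝ (Fin 3)) (L V : ℝ)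
          (Q : EuclideanSpace ℝ (Fin 3) ≃ₗᵢ[ℝ] EuclideanSpace ℝ (Fin 3))
          (W : EuclideanSpace ℝ (Fin 3) → EuclideanSpace ℝ (Fin 3)),
          0 < L ∧ 0 < V ∧ IsColumnar W ∧ (∀ x, ‖u t x‖ ≤ V) ∧
          (∃ x₁, dist x₁ x₀ ≤ L ∧ V ≤ 2 * ‖u t x₁‖) ∧
          (∃ y y' : EuclideanSpace ℝ (Fin 3), ‖y‖ ≤ 1 ∧ ‖y'‖ ≤ 1 ∧ (4 : ℝ)⁻¹ ≤ ‖W y - W y'‖) ∧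
          K * ν ≤ L * V ∧
          (∀ y : EuclideanSpace ℝ (Fin 3), ‖y‖ ≤ K →
            ‖V⁻¹ • Q.symm (u t (x₀ + L • Q y)) - W y‖ ≤ K⁻¹) ∧
          (T - t) * V ≤ K * L ∧ dist xs x₀ ≤ K * L / 4 :=
  anchoredLateWitness_of_floorWitnesses_subEulerRate (C := IsColumnar)
    (fun _ hW c _ => isColumnar_dilate hW c) hν hT hmax hLH hdec hsub hwfloor

/-- **Crux `MonopoleCoreExclusion` (stmt-1965): below the Euler rate the anchor stub needs only a core-radius floor.**
Binder shape of the registered stub `stub_anchoredLateAxisymWitness` (line `axisymmetric_comparison_flow`) with `hw`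
replaced by axisymmetric witnesses with a core-radius floor at every level frequently and the sub-Euler hypothesis.
[folklore] -/
theorem anchoredLateAxisymWitness_of_floorWitnesses_subEulerRate {ν T : ℝ}
    {u : ℝ → EuclideanSpace ℝ (Fin 3) → EuclideanSpace ℝ (Fin 3)}
    {p : ℝ → EuclideanSpace ℝ (Fin 3) → ℝ}
    (hν : 0 < ν) (hT : 0 < T) (hmax : IsMaximalSmoothSolution ν 0 u p T)
    (hLH : IsLerayHopfOn T ν 0 (u 0) u) (hdec : HasRapidSpatialDecay (u 0))
    (hsub : ∀ r : ℝ, 0 < r → ∃ t₁ : ℝ, t₁ < T ∧ ∀ t ∈ Ioo t₁ T, ∀ x, (T - t) * ‖u t x‖ ≤ r)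
    (hwfloor : ∃ r₀ : ℝ, 0 < r₀ ∧ ∀ K : ℝ, 0 < K → ∀ t₀ < T, ∃ t, t₀ < t ∧ t < T ∧
      ∃ (x₀ : EuclideanSpace ℝ (Fin 3)) (L V : ℝ)
        (Q : EuclideanSpace ℝ (Fin 3) ≃ₗᵢ[ℝ] EuclideanSpace ℝ (Fin 3))
        (W : EuclideanSpace ℝ (Fin 3) → EuclideanSpace ℝ (Fin 3)),
        0 < L ∧ 0 < V ∧ IsAxisymmetric W ∧ (∀ x, ‖u t x‖ ≤ V) ∧
        (∃ x₁, dist x₁ x₀ ≤ L ∧ V ≤ 2 * ‖u t x₁‖) ∧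
        (∃ y y' : EuclideanSpace ℝ (Fin 3), ‖y‖ ≤ 1 ∧ ‖y'‖ ≤ 1 ∧ (4 : ℝ)⁻¹ ≤ ‖W y - W y'‖) ∧
        K * ν ≤ L * V ∧
        (∀ y : EuclideanSpace ℝ (Fin 3), ‖y‖ ≤ K →
          ‖V⁻¹ • Q.symm (u t (x₀ + L • Q y)) - W y‖ ≤ K⁻¹) ∧
        r₀ ≤ K * L) :
    ∃ xs : EuclideanSpace ℝ (Fin 3),
      (¬ ∃ ρ M : ℝ, 0 < ρ ∧ ∀ s ∈ Ioo (T - ρ ^ 2) T, ∀ x ∈ ball xs ρ, ‖u s x‖ ≤ M) ∧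
      ∀ K : ℝ, 0 < K → ∃ t : ℝ, 0 < t ∧ t < T ∧
        ∃ (x₀ : EuclideanSpace ℝ (Fin 3)) (L V : ℝ)
          (Q : EuclideanSpace ℝ (Fin 3) ≃ₗᵢ[ℝ] EuclideanSpace ℝ (Fin 3))
          (W : EuclideanSpace ℝ (Fin 3) → EuclideanSpace ℝ (Fin 3)),
          0 < L ∧ 0 < V ∧ IsAxisymmetric W ∧ (∀ x, ‖u t x‖ ≤ V) ∧
          (∃ x₁, dist x₁ x₀ ≤ L ∧ V ≤ 2 * ‖u t x₁‖) ∧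
          (∃ y y' : EuclideanSpace ℝ (Fin 3), ‖y‖ ≤ 1 ∧ ‖y'‖ ≤ 1 ∧ (4 : ℝ)⁻¹ ≤ ‖W y - W y'‖) ∧
          K * ν ≤ L * V ∧
          (∀ y : EuclideanSpace ℝ (Fin 3), ‖y‖ ≤ K →
            ‖V⁻¹ • Q.symm (u t (x₀ + L • Q y)) - W y‖ ≤ K⁻¹) ∧
          (T - t) * V ≤ K * L ∧ dist xs x₀ ≤ K * L / 4 :=
  anchoredLateWitness_of_floorWitnesses_subEulerRate (C := IsAxisymmetric)
    (fun _ hW c _ => isAxisymmetric_dilate hW c) hν hT hmax hLH hdec hsub hwfloor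

end CoreExclusionAnchor

end Summit.NavierStokesRegularity.NavierStokesRegularity.Theorems

end
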